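import Summits.CriticalPhenomena.SAWScalingLimit.Theorems.SAWTensorRGRestrictionOfLimitGenericRestriction
import Mathlib.MeasureTheory.Measure.Portmanteau
import Mathlib.Topology.Algebra.Module.Cardinality

/-!
# `stub_restrictionOfSqueeze`: the restriction identity from an outer squeeze

Support file (`--supports stmt-CriticalPhenomena-0773`, registered stub `stub_restrictionOfSqueeze`, the glue G of
composition 2 `RestrictionOfLimit_of_squeeze`) of the line `birth` for the crux `RestrictionOfLimit` (shared
verbatim by the routes SAWConePseudogroup / SAWConfRestriction / SAWBrownianDomination / SAWTowerCount /
SAWTensorRG).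

`P` is a full scaling limit of the critical `δℤ²` SAW (`SAW.IsScalingLimitFamily P`), `D`, `D'` are
Dobrushin domains, `R = {γ ⊆ cl D'} = CurveClass.rangeSubset (closure D'.carrier)`, and
`E : ℝ → DobrushinDomain` is an OUTER SQUEEZE of `D'` inside `D`: for `t > 0`, `D' ⊆ E t ⊆ D` with the marked
points of `D`; SEPARATED, `cl (E s) ∩ cl (D ∖ E t) = ∅` for `0 < s < t` (which forces `E s ⊆ E t`);
EXHAUSTING, `γ ⊆ cl (E t)` for all `t > 0` implies `γ ⊆ cl D'`; and OUTER-CONTINUOUS,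
`∫ f dP(E t) → ∫ f dP(D')` as `t → 0⁺` for bounded continuous `f`. We prove the restriction identity
`P D' (T) · P D (R) = P D (T ∩ R)` for every Borel `T`.

Proof. If `P D (R) = 0` both sides vanish. Otherwise:
* generic restriction (`stub_restrictionOffCountable`, landed, on the separated family indexed by `{t // 0 < t}`)
  gives a countable exceptional set `S` of parameters off which `P (E t) (T) · P D (R_t) = P D (T ∩ R_t)`,
  `R_t = {γ ⊆ cl (E t)}`;
* `R_t ↓ R` as `t ↓ 0` (monotonicity from separation, exhaustion), so `P D (T ∩ R_t) → P D (T ∩ R)` along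
  `t → 0⁺` by continuity from above (`tendsto_measure_biInter_gt`), and off `S` the conditioned laws
  `P (E t) = P D (· ∩ R_t) / P D (R_t)` converge SETWISE to `ρ = P D (· ∩ R) / P D (R)`;
* the complement of the countable `S` is dense in `ℝ` (`Set.Countable.dense_compl`), so the filter
  `L = 𝓝[(0, ∞) ∖ S] 0` is proper (and countably generated); along `L` the probability measures `P (E t)`
  converge weakly both to `P D'` (outer continuity) and to `ρ` (setwise convergence on open sets is the liminf
  condition of the portmanteau theorem, `tendsto_of_forall_isOpen_le_liminf'`); weak limits of Borel
  probability measures on a metric space are unique (`ProbabilityMeasure` is Hausdorff), so `P D' = ρ`, which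
  is the identity.

No named fact is used; axioms `propext`, `Classical.choice`, `Quot.sound`. References: G. F. Lawler, O. Schramm,
W. Werner, *On the scaling limit of planar self-avoiding walk* (2004), §3.4.5; P. Billingsley, *Convergence of
probability measures* (1999), Thm 2.1 (portmanteau).
-/

noncomputable section

open MeasureTheory Filter Topology Set Metric Literature.Probability.RandomPlanarGeometry
  Literature.Probability.LatticeModels
open scoped ENNReal NNReal BoundedContinuousFunction

namespace Summit.CriticalPhenomena.SAWScalingLimit.Theorems.RestrictionOfLimit.Birth

/-! ### Three pieces of soft analysis -/

/-- **Separation forces nesting**: if `A ⊆ D` and `closure A ∩ closure (D ∖ B) = ∅` then `A ⊆ B` (a point of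
`A` outside `B` would lie in both closures). [folklore] -/
theorem subset_of_closure_inter_closure_diff_eq_empty {X : Type*} [TopologicalSpace X] {A B D : Set X}
    (hAD : A ⊆ D) (h : closure A ∩ closure (D \ B) = ∅) : A ⊆ B := by
  intro x hx
  by_contra hxB
  have hx' : x ∈ closure A ∩ closure (D \ B) := ⟨subset_closure hx, subset_closure ⟨hAD hx, hxB⟩⟩
  rw [h] at hx'
  exact hx'

/-- **Continuity from above along a real squeeze.** For a finite measure `μ`, a set `R` and measurable sets
`Rt t` (`t > 0`) that are monotone in `t`, contain `R` and exhaust it (`x ∈ Rt t` for all `t > 0` implies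
`x ∈ R`): `μ (T ∩ Rt t) → μ (T ∩ R)` as `t → 0⁺`, for every measurable `T`
(`tendsto_measure_biInter_gt` with `⋂_{t>0} (T ∩ Rt t) = T ∩ R`). [folklore] -/
theorem tendsto_measure_inter_of_squeeze {X : Type*} [MeasurableSpace X] {μ : Measure X}
    [IsFiniteMeasure μ] {R : Set X} {Rt : ℝ → Set X} (hmeas : ∀ t : ℝ, 0 < t → MeasurableSet (Rt t))
    (hmono : ∀ s t : ℝ, 0 < s → s ≤ t → Rt s ⊆ Rt t) (hsub : ∀ t : ℝ, 0 < t → R ⊆ Rt t)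
    (hexh : ∀ x : X, (∀ t : ℝ, 0 < t → x ∈ Rt t) → x ∈ R) {T : Set X} (hT : MeasurableSet T) :
    Tendsto (fun t : ℝ => μ (T ∩ Rt t)) (𝓝[>] (0 : ℝ)) (𝓝 (μ (T ∩ R))) := by
  have hI : (⋂ r > (0 : ℝ), (T ∩ Rt r)) = T ∩ R := by
    refine Subset.antisymm (fun x hx => ?_)
      (subset_iInter₂ fun t ht => inter_subset_inter_right _ (hsub t ht))
    have hx' := mem_iInter₂.1 hx
    exact ⟨(hx' 1 one_pos).1, hexh x fun t ht => (hx' t ht).2⟩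
  rw [← hI]
  exact tendsto_measure_biInter_gt (μ := μ) (s := fun r : ℝ => T ∩ Rt r)
    (fun r hr => (hT.inter (hmeas r hr)).nullMeasurableSet)
    (fun i j hi hij => inter_subset_inter_right _ (hmono i j hi hij)) ⟨1, one_pos, measure_ne_top _ _⟩

/-- **A weak limit is the setwise limit on open sets.** If probability measures `ms i` converge weakly to the
probability measure `ν` along a proper countably generated filter `L` (integrals of bounded continuous functions
converge) and `ms i (G) → ρ (G)` for every open `G`, `ρ` a probability measure, then `ν = ρ`: the second
hypothesis is the liminf condition of the portmanteau theorem (`tendsto_of_forall_isOpen_le_liminf'`), so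
`ms ⇒ ρ` too, and the space of Borel probability measures with the weak topology is Hausdorff
(`HasOuterApproxClosed`). [folklore] -/
theorem measure_eq_of_forall_integral_tendsto_of_forall_isOpen_tendsto {ι X : Type*} {L : Filter ι}
    [L.NeBot] [L.IsCountablyGenerated] [TopologicalSpace X] [HasOuterApproxClosed X] [MeasurableSpace X]
    [BorelSpace X] {ν ρ : Measure X} [hν : IsProbabilityMeasure ν] [hρ : IsProbabilityMeasure ρ]
    {ms : ι → Measure X} (hms : ∀ i, IsProbabilityMeasure (ms i))
    (hlim : ∀ f : X →ᵇ ℝ, Tendsto (fun i => ∫ x, f x ∂(ms i)) L (𝓝 (∫ x, f x ∂ν)))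
    (hset : ∀ G : Set X, IsOpen G → Tendsto (fun i => ms i G) L (𝓝 (ρ G))) : ν = ρ := by
  have h1 : Tendsto (β := ProbabilityMeasure X) (fun i => ⟨ms i, hms i⟩) L (𝓝 ⟨ν, hν⟩) :=
    ProbabilityMeasure.tendsto_iff_forall_integral_tendsto.2 hlim
  have h2 : Tendsto (β := ProbabilityMeasure X) (fun i => ⟨ms i, hms i⟩) L (𝓝 ⟨ρ, hρ⟩) :=
    tendsto_of_forall_isOpen_le_liminf' fun G hG => ((hset G hG).liminf_eq).ge
  have h := tendsto_nhds_unique h1 h2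
  simpa only [ProbabilityMeasure.coe_mk] using congrArg ProbabilityMeasure.toMeasure h

/-! ### The stub -/

/-- **Registered stub `stub_restrictionOfSqueeze` (glue G of composition 2) — restriction from an outer
squeeze.** For a full scaling-limit family `P` of the critical `δℤ²` SAW, Dobrushin `D`, `D'` and a family
`E : ℝ → DobrushinDomain` with, for `t > 0`, `D' ⊆ E t ⊆ D` and the marked points of `D`; SEPARATED
(`cl (E s) ∩ cl (D ∖ E t) = ∅` for `0 < s < t`); EXHAUSTING (`γ ⊆ cl (E t)` for all `t > 0` implies
`γ ⊆ cl D'`); and OUTER-CONTINUOUS (`∫ f dP(E t) → ∫ f dP(D')` as `t → 0⁺` for bounded continuous `f`): the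
restriction identity `P D' (T) · P D {γ ⊆ cl D'} = P D (T ∩ {γ ⊆ cl D'})` holds for every Borel `T`.
Proof: if `P D {γ ⊆ cl D'} = 0` both sides vanish; else generic restriction (`stub_restrictionOffCountable`)
off a countable set of parameters `t`, continuity from above `{γ ⊆ cl (E t)} ↓ {γ ⊆ cl D'}`
(`tendsto_measure_inter_of_squeeze`), density of the complement of a countable subset of `ℝ`, and
uniqueness of weak limits against setwise limits
(`measure_eq_of_forall_integral_tendsto_of_forall_isOpen_tendsto`). Lawler–Schramm–Werner 2004, §3.4.5.
[folklore] -/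
theorem stub_restrictionOfSqueeze :
    ∀ P : ChordalFamily, SAW.IsScalingLimitFamily P →
      ∀ (D D' : DobrushinDomain) (E : ℝ → DobrushinDomain),
        (∀ t : ℝ, 0 < t → D'.carrier ⊆ (E t).carrier ∧ (E t).carrier ⊆ D.carrier ∧
          (E t).pt 0 = D.pt 0 ∧ (E t).pt 1 = D.pt 1) →
        (∀ s t : ℝ, 0 < s → s < t → closure (E s).carrier ∩ closure (D.carrier \ (E t).carrier) = ∅) →
        (∀ γ : CurveClass ℂ, (∀ t : ℝ, 0 < t → γ.range ⊆ closure (E t).carrier) →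
          γ.range ⊆ closure D'.carrier) →
        (∀ f : CurveClass ℂ →ᵇ ℝ, Tendsto (fun t : ℝ => ∫ γ, f γ ∂(P (E t))) (𝓝[>] (0 : ℝ))
          (𝓝 (∫ γ, f γ ∂(P D')))) →
        ∀ T : Set (CurveClass ℂ), MeasurableSet T →
          P D' T * P D (CurveClass.rangeSubset (closure D'.carrier)) =
            P D (T ∩ CurveClass.rangeSubset (closure D'.carrier)) := by
  intro P hP D D' E hN hS hX hC T hT
  haveI : IsProbabilityMeasure (P D) := hP.isProbabilityMeasure D
  haveI : IsProbabilityMeasure (P D') := hP.isProbabilityMeasure D'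
  set R : Set (CurveClass ℂ) := CurveClass.rangeSubset (closure D'.carrier) with hR
  -- the degenerate case `P D (R) = 0`
  by_cases hR0 : P D R = 0
  · rw [hR0, mul_zero]
    exact (le_antisymm ((measure_mono Set.inter_subset_right).trans hR0.le) bot_le).symm
  -- nesting of the squeeze (from separation) and of the events `{γ ⊆ cl (E t)}`
  have hmonoE : ∀ s t : ℝ, 0 < s → s ≤ t → (E s).carrier ⊆ (E t).carrier := by
    intro s t hs hst
    rcases hst.eq_or_lt with rfl | hlt
    · exact Subset.rfl
    · exact subset_of_closure_inter_closure_diff_eq_empty (hN s hs).2.1 (hS s t hs hlt)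
  have hmonoR : ∀ s t : ℝ, 0 < s → s ≤ t →
      (CurveClass.rangeSubset (closure (E s).carrier) : Set (CurveClass ℂ)) ⊆
        CurveClass.rangeSubset (closure (E t).carrier) :=
    fun s t hs hst γ hγ => CurveClass.mem_rangeSubset.2
      ((CurveClass.mem_rangeSubset.1 hγ).trans (closure_mono (hmonoE s t hs hst)))
  have hRsub : ∀ t : ℝ, 0 < t → R ⊆ CurveClass.rangeSubset (closure (E t).carrier) :=
    fun t ht γ hγ => CurveClass.mem_rangeSubset.2
      ((CurveClass.mem_rangeSubset.1 hγ).trans (closure_mono (hN t ht).1))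
  -- continuity from above along `t → 0⁺`
  have hcont : ∀ T' : Set (CurveClass ℂ), MeasurableSet T' →
      Tendsto (fun t : ℝ => P D (T' ∩ CurveClass.rangeSubset (closure (E t).carrier))) (𝓝[>] (0 : ℝ))
        (𝓝 (P D (T' ∩ R))) := fun T' hT' =>
    tendsto_measure_inter_of_squeeze (μ := P D)
      (Rt := fun t : ℝ => (CurveClass.rangeSubset (closure (E t).carrier) : Set (CurveClass ℂ)))
      (fun t _ => CurveClass.measurableSet_rangeSubset isClosed_closure) hmonoR hRsub
      (fun γ hγ => CurveClass.mem_rangeSubset.2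
        (hX γ fun t ht => CurveClass.mem_rangeSubset.1 (hγ t ht))) hT'
  -- generic restriction off a countable set of parameters
  obtain ⟨S, hSc, hSgood⟩ := stub_restrictionOffCountable P hP D {t : ℝ // 0 < t} (fun i => E i.1)
    (fun i => (hN i.1 i.2).2.1) (fun i => (hN i.1 i.2).2.2.1) (fun i => (hN i.1 i.2).2.2.2)
    (fun i j hij => by
      rcases lt_or_gt_of_ne (fun h : i.1 = j.1 => hij (Subtype.ext h)) with h | h
      · exact Or.inl (hS i.1 j.1 i.2 h)
      · exact Or.inr (hS j.1 i.1 j.2 h))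
  have hgood : ∀ t : ℝ, 0 < t → t ∉ (Subtype.val '' S : Set ℝ) →
      ∀ T' : Set (CurveClass ℂ), MeasurableSet T' →
        P (E t) T' * P D (CurveClass.rangeSubset (closure (E t).carrier)) =
          P D (T' ∩ CurveClass.rangeSubset (closure (E t).carrier)) :=
    fun t ht htS T' hT' => hSgood ⟨t, ht⟩ (fun h => htS ⟨⟨t, ht⟩, h, rfl⟩) T' hT'
  -- the proper filter `L = 𝓝[(0, ∞) ∖ S] 0`
  have hdense : Dense (Subtype.val '' S : Set ℝ)ᶜ := (hSc.image _).dense_compl ℝ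
  have h0 : (0 : ℝ) ∈ closure (Ioi (0 : ℝ) ∩ (Subtype.val '' S : Set ℝ)ᶜ) := by
    refine closure_minimal (hdense.open_subset_closure_inter isOpen_Ioi) isClosed_closure ?_
    rw [closure_Ioi]
    exact self_mem_Ici
  haveI : (𝓝[Ioi (0 : ℝ) ∩ (Subtype.val '' S : Set ℝ)ᶜ] (0 : ℝ)).NeBot :=
    mem_closure_iff_nhdsWithin_neBot.1 h0
  have hL : 𝓝[Ioi (0 : ℝ) ∩ (Subtype.val '' S : Set ℝ)ᶜ] (0 : ℝ) ≤ 𝓝[>] (0 : ℝ) :=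
    nhdsWithin_mono _ inter_subset_left
  -- the conditioned law `ρ = P D (· ∩ R) / P D (R)`
  obtain ⟨ρ, hρ⟩ : ∃ ρ : Measure (CurveClass ℂ), ∀ T' : Set (CurveClass ℂ), MeasurableSet T' →
      ρ T' = P D (T' ∩ R) / P D R :=
    ⟨(P D R)⁻¹ • (P D).restrict R, fun T' hT' => by
      rw [Measure.smul_apply, Measure.restrict_apply hT', smul_eq_mul, ENNReal.div_eq_inv_mul]⟩
  haveI hρP : IsProbabilityMeasure ρ :=
    ⟨by rw [hρ _ MeasurableSet.univ, univ_inter, ENNReal.div_self hR0 (measure_ne_top _ _)]⟩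
  -- setwise convergence of `P (E t)` to `ρ` along `L`
  have hset : ∀ T' : Set (CurveClass ℂ), MeasurableSet T' →
      Tendsto (fun t : ℝ => P (E t) T') (𝓝[Ioi (0 : ℝ) ∩ (Subtype.val '' S : Set ℝ)ᶜ] (0 : ℝ))
        (𝓝 (ρ T')) := by
    intro T' hT'
    have hnum := (hcont T' hT').mono_left hL
    have hden : Tendsto (fun t : ℝ => P D (CurveClass.rangeSubset (closure (E t).carrier)))
        (𝓝[Ioi (0 : ℝ) ∩ (Subtype.val '' S : Set ℝ)ᶜ] (0 : ℝ)) (𝓝 (P D R)) := by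
      simpa only [univ_inter] using (hcont univ MeasurableSet.univ).mono_left hL
    rw [hρ T' hT']
    refine (ENNReal.Tendsto.div hnum (Or.inr hR0) hden (Or.inl (measure_ne_top _ _))).congr' ?_
    filter_upwards [self_mem_nhdsWithin] with t ht
    have hne : P D (CurveClass.rangeSubset (closure (E t).carrier)) ≠ 0 :=
      fun h => hR0 (measure_mono_null (hRsub t ht.1) h)
    refine ((ENNReal.eq_div_iff hne (measure_ne_top _ _)).2 ?_).symm
    rw [mul_comm]
    exact hgood t ht.1 ht.2 T' hT'
  -- `P D'` and `ρ` are weak limits of `P (E t)` along `L`, hence equal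
  have hνρ : P D' = ρ :=
    measure_eq_of_forall_integral_tendsto_of_forall_isOpen_tendsto
      (L := 𝓝[Ioi (0 : ℝ) ∩ (Subtype.val '' S : Set ℝ)ᶜ] (0 : ℝ)) (ms := fun t : ℝ => P (E t))
      (fun t => hP.isProbabilityMeasure (E t)) (fun f => (hC f).mono_left hL)
      (fun G hG => hset G hG.measurableSet)
  rw [hνρ, hρ T hT]
  exact ENNReal.div_mul_cancel hR0 (measure_ne_top _ _)

end Summit.CriticalPhenomena.SAWScalingLimit.Theorems.RestrictionOfLimit.Birth

end
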